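import Summits.BirchSwinnertonDyer.BirchSwinnertonDyer.Theorems.ByReductionTypeAtTwoRankOneAtTwoOneDoorFirstDescentDefs
import Summits.BirchSwinnertonDyer.BirchSwinnertonDyer.Theorems.ByReductionTypeAtTwoRankOneAtTwoBigImageOddLocalOneDoorFirstDescentPairAtTwo
import Summits.BirchSwinnertonDyer.BirchSwinnertonDyer.Theorems.ByReductionTypeAtTwoRankOneAtTwoBigImageOddLocalOneDoorBottomSelmerGlue
import Summits.BirchSwinnertonDyer.BirchSwinnertonDyer.Theorems.ByReductionTypeAtTwoRankOneAtTwoBigImageOddLocalOneDoorBottomTwinParity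
import HarnessLib

/-!
# Route ByReductionTypeAtTwo, crux `RankOneAtTwoBigImageOddLocal` (stmt-BirchSwinnertonDyer-23715), LINE v8.9 `one_door_analytic`:
# the FRAME of the bottom rung — `FirstDescentInput W Wd ⟹ #Sel₂(W/ℚ) = 2 ∧ Sel₂(Wd/ℚ) = ⊥ ⟹ U₀`

Lead prover seat `bsd-line-fkl-p1` g12 (2026-08-28), `--supports stmt-BirchSwinnertonDyer-23715` (helper).  THEOREMS ONLY; no
definition, no named fact introduced, no `sorry`; BSD is not proved by any of this.

The two abstract halves of Kolyvagin's first `2`-descent over `ℚ` — E-side `card_sel_eq_two` (`Theorems/…OneDoorFirstDescentAtTwo.lean`,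
p637958: `Sel₂(E/ℚ) = {0, y}`) and twin side `twinSel_eq_bot₂` (`Theorems/…OneDoorFirstDescentPairAtTwo.lean`, p641149:
`Sel₂(E^{(d)}/ℚ) = 0`, two-space form) — are INSTANTIATED on the tree's carriers: `V₁ = galH1Torsion W 2 = H¹(ℚ, W[2])`,
`V₂ = galH1Torsion Wd 2`, local conditions `locAt` (Kummer, `selmerLocalKer`) / `strictAt` (`torsionLocalKer`) at every place of `ℚ`,
`Sel = selmerGroup · 2` (cut out by `locAt`: `mem_selmerGroup_iff_forall_locAt`), the remaining leaves being the fields of the record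
`FirstDescentInput W Wd` (`Theorems/…OneDoorFirstDescentDefs.lean`):

* §1 `card_selmerTwo_eq_of_input` — `FirstDescentInput W Wd` + parity of `Sel₂(Wd/ℚ)` ⟹ `#Sel₂(W/ℚ) = 2 ∧ Sel₂(Wd/ℚ) = ⊥`;
  `card_selmerTwo_le_of_input` — the two counts `≤ 2`, `≤ 1`;
* §2 `doorIndexLawUpperCAtTwoBottom_of_leaves` — **U₀ `DoorIndexLawUpperCAtTwoBottom` from `FirstDescentLeavesAtTwoBottom`**, the four
  primary printed facts of `S_pub4` (Gross–Zagier, Kolyvagin, modularity, Hoffstein–Luo) and the Cassels–Tate pairing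
  (`exists_casselsTate_pairing`, named fact): the width seat's Selmer-to-door glue `doorIndexLawUpperCAtTwoBottom_of_selmerTwo`
  (`…OneDoorBottomSelmerGlue.lean`) and parity leaf `twin_selmerTwo_even_at` (`…OneDoorBottomTwinParity.lean`) close the frame;
  `doorIndexLawUpperCAtTwoBottomNeg_of_leaves` — the `Δ_W < 0` corner U₀⁻ as a corollary (`doorIndexLawUpperCAtTwoBottomNeg_of_bottom`).

So the registered stub of skeleton v8.9 is `stub_firstDescentLeaves : FirstDescentLeavesAtTwoBottom` («the input exists at every
bottom-rung datum») next to the PRINT stub `stub_pubCT`, and every remaining obligation of the bottom rung is ONE FIELD of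
`FirstDescentInput` with a fixed tree signature.

References: [GrossLMS1991] Props. 2.3, 6.2, 9.1 and §10; [McCallumLMS1991] Cor. 3.2, Prop. 4.4, Lemma 5.3; [MazurRubin2010] Lemmas 2.2,
2.10; [Kolyvagin1989Izv] §3; [Cassels1962ArithmeticIV] Thm. 1.1; [SilvermanAEC2009] Thm. X.4.2.
-/

set_option autoImplicit false
-- the Theorems namespace of this sub repeats the summit name by design (D-0017 nested layout)
set_option linter.dupNamespace false

noncomputable section

open scoped Classical

namespace Summit.BirchSwinnertonDyer.BirchSwinnertonDyer.Theorems.RankOneAtTwoOneDoor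

open WeierstrassCurve NumberField Literature.NumberTheory.EllipticCurves Literature.NumberTheory.EllipticCurves.ModularForms
  Summit.BirchSwinnertonDyer.Rank1Residual.F1Sign2
  Summit.BirchSwinnertonDyer.Rank1Residual.F1Sign2.TranspositionDoor
  Summit.BirchSwinnertonDyer.BirchSwinnertonDyer.Theses.ByReductionTypeAtTwo

/-! ### §1 The engine instantiated on `H¹(ℚ, W[2])` and `H¹(ℚ, Wd[2])` -/

/-- **`#Sel₂(W/ℚ) = 2` and `Sel₂(Wd/ℚ) = ⊥` from a first-descent input and parity.**  E-side: `card_sel_eq_two` with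
`V = galH1Torsion W 2`, `Loc = locAt W 2`, `A ℓ = strictAt W 2 (pl ℓ)`, `A₀ = strictAt W 2 q₀`, `Sel = selmerGroup W 2`; twin side:
`twinSel_eq_bot₂` with `V₂ = galH1Torsion Wd 2`, `Loc₂ = locAt Wd 2`, `A₂ ℓ = strictAt Wd 2 (pl ℓ)`, `Sel₂ = selmerGroup Wd 2` and the
parity input `heven`.  [cite: GrossLMS1991, Prop. 2.3 and §10] [cite: Kolyvagin1989Izv, §3 (Thm. B_l, l = 2)] -/
theorem card_selmerTwo_eq_of_input (W Wd : WeierstrassCurve ℚ) (I : FirstDescentInput W Wd)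
    (heven : ∀ s ∈ selmerGroup Wd 2, s ≠ 0 → ∃ t ∈ selmerGroup Wd 2, t ≠ 0 ∧ t ≠ s) :
    Nat.card (selmerGroup W 2) = 2 ∧ selmerGroup Wd 2 = ⊥ := by
  refine ⟨?_, ?_⟩
  · exact card_sel_eq_two (locAt W 2) I.q₀ (strictAt W 2 I.q₀) I.Kol I.pl (fun ℓ => strictAt W 2 (I.pl ℓ)) I.y I.c₁
      I.c₁_loc I.c₁_loc_iff I.rec₁ I.ceb₂ I.ceb₁ I.line₁ (selmerGroup W 2) (mem_selmerGroup_iff_forall_locAt W 2) I.y_mem I.y_ne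
  · exact twinSel_eq_bot₂ (locAt Wd 2) I.q₀ (strictAt Wd 2 I.q₀) I.Kol I.pl (fun ℓ => strictAt W 2 (I.pl ℓ))
      (fun ℓ => strictAt Wd 2 (I.pl ℓ)) I.y I.c₂ I.c₂_loc I.c₂_loc_iff I.rec₂ I.ceb₂' I.line₂ (selmerGroup Wd 2)
      (mem_selmerGroup_iff_forall_locAt Wd 2) heven

/-- **The two `2`-Selmer counts `#Sel₂(W/ℚ) ≤ 2 ∧ #Sel₂(Wd/ℚ) ≤ 1`** — the hypothesis currency of the Selmer-to-door glue
`doorIndexLawUpperCAtTwoBottom_of_selmerTwo`. [cite: GrossLMS1991, Prop. 2.3 and §10] -/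
theorem card_selmerTwo_le_of_input (W Wd : WeierstrassCurve ℚ) (I : FirstDescentInput W Wd)
    (heven : ∀ s ∈ selmerGroup Wd 2, s ≠ 0 → ∃ t ∈ selmerGroup Wd 2, t ≠ 0 ∧ t ≠ s) :
    Nat.card (selmerGroup W 2) ≤ 2 ∧ Nat.card (selmerGroup Wd 2) ≤ 1 := by
  obtain ⟨h1, h2⟩ := card_selmerTwo_eq_of_input W Wd I heven
  refine ⟨h1.le, ?_⟩
  rw [h2, AddSubgroup.card_bot]

/-! ### §2 U₀ from the leaves -/

/-- **U₀ `DoorIndexLawUpperCAtTwoBottom` FROM THE LEAVES**: `FirstDescentLeavesAtTwoBottom` (the input exists at every bottom-rung datum),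
the four primary printed facts (Gross–Zagier, Kolyvagin, modularity as a newform, Hoffstein–Luo — for `rank W(ℚ) = 1` and the readout) and
the Cassels–Tate pairing (parity of `dim Sel₂(Wd/ℚ)`) give the bottom rung.  Conditional by design (named printed facts as hypotheses);
BSD is not proved by this. [cite: GrossLMS1991, Props. 2.3, 6.2 and §10] [cite: Kolyvagin1990, Thm. A] [cite: Cassels1962ArithmeticIV, Thm. 1.1] -/
theorem doorIndexLawUpperCAtTwoBottom_of_leaves
    (hGZ : ∀ (N : ℕ) [NeZero N] (W : WeierstrassCurve ℚ) (K : Type) [Field K] [NumberField K], gross_zagier N W K)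
    (hKo : ∀ (N : ℕ) [NeZero N] (W : WeierstrassCurve ℚ) (K : Type) [Field K] [NumberField K], kolyvagin N W K)
    (hnf : exists_isNewformOf) (hHL : HoffsteinLuo1997_exists_twist_L_one_ne_zero)
    (hCT : exists_casselsTate_pairing (K := ℚ)) (hL : FirstDescentLeavesAtTwoBottom) :
    DoorIndexLawUpperCAtTwoBottom := by
  refine doorIndexLawUpperCAtTwoBottom_of_selmerTwo hGZ hKo hnf hHL ?_
  intro W _ _ _ hCM hsurj hT hc hr K _ _ hK hadm hLt Dt H ι P hP Wd _ _ Cd hWd hmin hodd hm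
  obtain ⟨I⟩ := hL W hCM hsurj hT hc hr K hK hadm hLt Dt H ι P hP Wd Cd hWd hmin hodd hm
  have hrQ : W.mordellWeilRank = 1 :=
    (mordellWeilRank_eq_one_of_analyticRank_eq_one_of_isGloballyMinimal hGZ hKo hnf hHL W hr).1
  exact card_selmerTwo_le_of_input W Wd I (fun s hs h0 =>
    twin_selmerTwo_even_at hCT hnf W hT hr hrQ K hK (hGZ _ W K) (hKo _ W K) hadm hLt Dt H ι P hP Wd Cd hWd hs h0)

/-- **U₀⁻ `DoorIndexLawUpperCAtTwoBottomNeg` from the leaves** (the `Δ_W < 0` corner, by `doorIndexLawUpperCAtTwoBottomNeg_of_bottom`).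
[cite: GrossLMS1991, §10] [cite: Kolyvagin1990, Thm. A] -/
theorem doorIndexLawUpperCAtTwoBottomNeg_of_leaves
    (hGZ : ∀ (N : ℕ) [NeZero N] (W : WeierstrassCurve ℚ) (K : Type) [Field K] [NumberField K], gross_zagier N W K)
    (hKo : ∀ (N : ℕ) [NeZero N] (W : WeierstrassCurve ℚ) (K : Type) [Field K] [NumberField K], kolyvagin N W K)
    (hnf : exists_isNewformOf) (hHL : HoffsteinLuo1997_exists_twist_L_one_ne_zero)
    (hCT : exists_casselsTate_pairing (K := ℚ)) (hL : FirstDescentLeavesAtTwoBottom) :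
    DoorIndexLawUpperCAtTwoBottomNeg :=
  doorIndexLawUpperCAtTwoBottomNeg_of_bottom (doorIndexLawUpperCAtTwoBottom_of_leaves hGZ hKo hnf hHL hCT hL)

end Summit.BirchSwinnertonDyer.BirchSwinnertonDyer.Theorems.RankOneAtTwoOneDoor

end
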